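import Summits.QuantumFields.YangMills.Theorems.BalabanUVNodesN20CoreEdgeTwoRunKeyed
import Summits.QuantumFields.YangMills.Theorems.BalabanUVNodesN19CoreMetric
import Literature.MathematicalPhysics.QuantumFieldTheory.Balaban1983to89.Node00.TwoRunSitePersistence
import Literature.MathematicalPhysics.QuantumFieldTheory.Balaban1983to89.T4BadClassBooking

/-!
# BalabanUVNodes ∕ N20 (NE7b) — the `hedge`-JOINT COMPANION of the keyed relative-weight socket, module 2 of 2 (the (α)-reading edition): N19's core
# edge at n19-d's σ-packed two-run keyed data with the SHARED persistence class `Bad K t := badKeysSigma F (T K) jcut` of `Node00/TwoRunSitePersistence`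
# IS a termwise sandwich on the run-A (2.18) sequences whose history is SMALL-FIELD up to the cut level (`Λ_j = T_η`, `1 ≤ j ≤ jcut K`) — loss-free —,
# and the composition with B §2's four-estimate road at that ONE bad class

Cell `pub-ymgap` (HUMAN RULING D-0062 Track A; D-0149 width push, director-ym №197), seat `pub-ymgap-dag-n20-w3` (WIDTH SEAT 3 of 3 on NODE n20 = NE7b) gen 0;
W-SEAT-START-LIST v3 §2 n20 ITEM 3 as RE-POINTED by plan g77 (pub-ymgap INBOX l.24047); continuation of module 1 `Thm/BalabanUVNodesN20CoreEdgeTwoRunKeyed`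
(§1 abstract keyed two-source cores + joint guard, §2 the two-run keys with `Bad` generic).  Filed `--kind proof --supports stmt-QuantumFields-20544 --as helper`
(K3⁷ `SpineGivenEndpointR13SepCoPH`); COUNT-NEUTRAL.  [III] = [Balaban1988Convergent], [LF-I] = [Balaban1989LargeFieldI], [LF-II] = [Balaban1989LargeFieldII].

WHY THIS FILE.  dag-n20-d's `Node00/TwoRunSitePersistence` (p-id of INTENT-2 l.24056) fixes the bad key class that N20's `h20`, N21's `h21` and N19's `hedge`
SHARE at n19-d's face B (`Thm/BalabanUVNodesN19TargetClassWeightsTwoRunKeyed` :169): `badKeysSigma F (T K) jcut` — the σ-keys whose key carries an OLD large-field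
region `Λ_j ≠ T_η` at some level `1 ≤ j ≤ jcut K` (`KeyOldLargeField`), level policy `jcut` DISPLAYED (NE7b's is `jcut K = K₀ + K − j⋆(K)`, the estimate's
choice).  n20-w1's socket and n20-w2's bad-fibre weight say what `h20` then asks of the two runs' (2.18) TERMS; this file says what `hedge` asks of them:
* §3 `sigma_twoRunKeyA_not_mem_badKeysSigma_iff` — run A's σ-key of `s` is GOOD iff `s.Λ_j = T_η` for all `1 ≤ j ≤ jcut K` (n20-d's `mem_badKeysSigma_iff` +
  `not_keyOldLargeField_iff`; run A's key only forgets admissibility); ★★ `core_twoRunKeyed_badKeysSigma_iff_termwise` — module 1's ★★ iff with the good-class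
  premise READ at the objects: `NE7.Core` at the persistence class IFF, for every `K`, ONE constant `c` sandwiches run B's `truncSeq`-fibre core against run A's
  term core, `e^{c ∓ vol·δ K}`, on EVERY run-A sequence at cutoff `K₀ + K` with NO large-field region at the old levels `≤ jcut K` (the recent window is free);
  ★★ `coreEdge_twoRunKeyed_badKeysSigma_of_termwise` — B :169's `hedge` binder at this `Bad` from that sandwich + `Summable δ`;
* §3b THE CUT TRADE-OFF (any class-set family `T` over the σ-keys): `badKeysSigma_mono_policy` (a later cut excuses more keys), `core_badKeysSigma_of_policy_le`
  (`NE7.Core` at policy `jcut` ⇒ at every `jcut' ≥ jcut`, `…N19CoreMetric.core_of_subset`) and `relWeightBound_badKeysSigma_of_policy_le` (`RelWeightBound` at `jcut'`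
  ⇒ at every `jcut ≤ jcut'`, nonnegative terms, `T4BadClassBooking.relWeightBound_mono`): raising the cut WEAKENS `hedge` and STRENGTHENS `h20` — the joint content
  of the pair lives in the window of policies where both hold (NE7b's: `jcut K = K₀ + K − j⋆(K)`, `j⋆` the recent-scale depth; not chosen here);
* §4 ★★ `matching_scheme_of_termwise_relWeight_shell_twoRunKeyed_badKeysSigma_liveRepin₁₃` — B §2's road `matching_scheme_of_coreEdge_twoRunKeyed_liveRepin₁₃` BY
  NAME at the ₁₃ live re-pin with `Bad K t := badKeysSigma F (T K) jcut` in ALL FOUR estimates, `hedge` DISCHARGED by §3 at F3's class weights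
  `classWeightOfDatum₉ … (θ.liveRepin₁₃ F N).toStage9Params …`; DISPLAYED: `hres hM`, bookkeeping, the flow hypothesis `hR`, the policy `jcut`, `hl₀ hvol`, `h20`
  (n20-w1's socket ∕ n20-w2's weight feed it at this class), `h21`, `hlt`, `hδ`, THE TERMWISE SANDWICH — nothing else ⇒ node U5's `∃ δ′, Summable δ′ ∧
  MatchingModConstants vol l₀ δ′ (schemeZ (D.scheme g₀) os)`.

(α) READING STATED (NC-NE7b-α UNRULED, chair ASK-1): dag-n20-d's — `Bad` = keys with an OLD large-field region below the cut (`T4WeightBudget` :117 «old pending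
large-field structure»; [LF-II] (1.80) p.384, (1.85)–(1.89) pp.386–387); on the good class both runs' histories are small-field at every old level (run B one
level up: n20-d's `exists_Λ_succ_ne_univ_of_keyOldLargeField_twoRunKeyB` ∕ n20-w2's exactness lemma), which is where the two runs' effective actions are
Bałaban's small-field flows [B13]–[B15] — the regime N19's rates NE1′–NE5 speak about.  This file does not choose `j⋆`.
LOCATED (this seat, pub-ymgap bus l.24338 ∕ l.24378 ∕ resolution): WITHIN one (2.18) sequence the chain is antitone (`Chain21.Λ_antitone`), so «bad at policy `jcut`»
reads «`Λ_{jcut K} ≠ T_η`» (n20-w2's `…_iff_last`).  It means «a structure born `≤ jcut K` is STILL PENDING» — what NE7b wants — exactly when the record's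
𝐑-step is HISTORY-REWRITING: def-R's `Node00/RStepRepr218` re-indexes each step by the selector `a ↦ a″` and `Node00/LargeFieldTowerOfRecord.PpSelOfRecord`
(= `θ.ppSel`, RESIDUAL data) has the intended meaning «the term with the renormalised components `Z′` declared small» ([IV] (0.3) p.176 `Z″ = Z ∖ Z′`), which
— admissibility forcing it — removes `Z′` from EVERY entry `Λ_j, Ω_j`, `j ≥ j(Z′)` (design (ρ2)).  Under a JUNK pin of `θ.ppSel` (identity: `R` of record =
identity, `ROperationOfRecord` §4's convention) the index ACCUMULATES every region ever created (ρ1), the good class sits inside `{Λ_1 = T_η}` («no finest-level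
large field anywhere»), and by the volume count `L^{4(K₀+K)}` blocks against `e^{−C·p₀(g_1)²}`, `p₀(g)² = A₀²(log g⁻²)^{2p₀}` (`Setup.p0Profile`), its share of
either run's mass is not bounded below as `K → ∞`: NO `RelWeightBound` with `Summable W` is then to be expected at this class.  The faces below are bookkeeping
at the INTENDED pin (ρ2); they are vacuous-by-falsity of `h20` at a junk pin — stated so that no reader books them otherwise.

HONEST FRAMING.  Count-neutral kernel bookkeeping (module 1 + n20-d's predicate + B §2 BY NAME; nothing re-typed).  It proves NO estimate: the displayed termwise
sandwich on small-field histories for Bałaban's class weights IS N19's NE7 core content (route H1L) jointly cut with N20's persistence class — NOT PRINTED for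
`d = 4` ([LF-II] p.356; [King1986] (3.10)–(3.13) pp.656–657 is the abelian `d = 2,3` template), NOT proved, NAMED OPEN; A6 (№189): LOCATED — no Bałaban family
inhabits it today; §3's ★★ is an `iff` (not vacuous as a statement), §4 displays every estimate it consumes.  NE7 ∕ NE7b NOT PRINTED ∕ NOT PROVED; (α)-instance
0∕1; N19 ∕ N20 ∕ N21 ∕ N27 NOT discharged; K3⁷ NOT closed; counts unmoved (typed 28∕28 · discharged 5∕27); no count claim.  One finite `𝕋⁴_{L^K}` programme at
fixed `ε = L^{−K}` along two consecutive cutoffs, Bałaban AS PRINTED; the YM mass gap (Clay) is NOT proved by any of this — R4 closes the conditional finite-𝕋⁴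
rung `BalabanLadder.UV` only; NOT ℝ⁴, NOT OS, NOT a mass gap.  No `instance`, no `notation`, no `def`, no `sorry`.
Sources (bookkeeping): [III] (2.1) p.254, (2.18) p.257; [LF-I] (0.2)–(0.4) p.176; [LF-II] Thm 1 + (0.1) pp.355–356, (1.80) p.384; [King1986] (3.10) p.656;
[Balaban1985UV3] (6) p.257.

v1.1 (APPEND-ONLY, DOCSTRING-ONLY edition; gen 2 of this seat; every declaration byte-identical).  Answers ref-O g2 READ-30 (pub-ymgap INBOX l.≈26366, PASS, NITs 1–3):
NIT-3 — the tag «[IV]» in the (α)∕LOCATED paragraph above is [LF-I] = [Balaban1989LargeFieldI] ((0.3) p.176, `Z″ = Z ∖ Z′`); NIT-2 — the «SHARPER FORM» paragraph in the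
docstring of `core_twoRunKeyed_badKeysSigma_iff_termwise` is PROSE ONLY in this file (its `hterm` keeps the full block-down fibre sum); the singleton-fibre form is module 4
`Thm/BalabanUVNodesN20CoreEdgeLiftedTerm` (p588556, `core_twoRunKeyed_badKeysSigma_iff_liftedTerm`), and at dag-n21-d's shell split of record modules 7–9
`Thm/BalabanUVNodesN20CoreEdgeAtShellSplitOfRecord{,Transfer,Fibre}` (term vs lifted term ∕ fibre summed, lowered-threshold forms); NIT-1 — §3's run-A goodness lemma
closes by `rfl` over n20-d's `mem_badKeysSigma_iff` ∕ `not_keyOldLargeField_iff`; `keyOldLargeField_twoRunKeyA_iff` is cited for the READING, not used in the proof.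
Nothing else changes; count-neutral; the YM mass gap (Clay) is NOT proved by any of this.
-/

noncomputable section

namespace Summit.QuantumFields.YangMills.BalabanUVNodes.N20CoreEdgeAtPersistentKeys

open MeasureTheory Literature.MathematicalPhysics.QuantumFieldTheory.Balaban1983to89 Literature.MathematicalPhysics.QuantumFieldTheory.Balaban1983to89.Node00
open scoped BigOperators Matrix.Norms.L2Operator
open T4Continuum B14.Eq218Concrete Summit.QuantumFields.BalabanUV.T4Continuum.Spine
open T4WeightBudget (RelWeightBound)
open T4IndicatorShell (ShellWeightBound)
open T4CauchySum (MatchingModConstants)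
open Summit.QuantumFields.YangMills.BalabanUVNodes.N19TargetClassWeightsTwoRunKeyed (matching_scheme_of_coreEdge_twoRunKeyed_liveRepin₁₃)
open Summit.QuantumFields.YangMills.BalabanUVNodes.N20CoreEdgeTwoRunKeyed (core_twoRunKeyed_iff_termwise)
open Summit.QuantumFields.YangMills.BalabanUVNodes.N19CoreMetric (core_of_subset)
open T4BadClassBooking (relWeightBound_mono)

/-! ## §3 THE (α)-READING EDITION: the SHARED bad class `Bad K t := badKeysSigma F (T K) jcut` of `Node00/TwoRunSitePersistence` (dag-n20-d) — a GOOD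
run-A sequence is one whose history is SMALL-FIELD up to the cut level, `Λ_j = T_η` for `1 ≤ j ≤ jcut K` -/

section Persistent

variable (F : T4Family) (ν : Stage7Numerics) (K₀ : ℕ) {M : ℕ} (hM : 0 < M) {gA gB : ℕ → ℕ → ℝ}

/-- **THE GOOD-CLASS READING AT RUN A's σ-KEY**: for any class set `T` containing the σ-packed run-A key of `s`, that key is OUTSIDE the persistence class
`badKeysSigma F T jcut` iff `s` has NO old large-field region: `s.Λ_j = T_η` at every level `1 ≤ j ≤ jcut K` (dag-n20-d's `mem_badKeysSigma_iff` +
`not_keyOldLargeField_iff`; run A's key forgets admissibility only, `keyOldLargeField_twoRunKeyA_iff`).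
[cite: Balaban1989LargeFieldII, (1.80) p.384; Balaban1989LargeFieldI, (0.2) p.176; Balaban1988Convergent, (2.18) p.257 (bookkeeping)] -/
theorem sigma_twoRunKeyA_not_mem_badKeysSigma_iff (jcut : ℕ → ℕ) {K : ℕ} {T : Finset (Σ K, SiteSeqKey F (K₀ + K))}
    (s : SeqOfRecord F ν M (gA K) (K₀ + K) (K₀ + K))
    (hT : (⟨K, twoRunKeyA F ν M (gA K) (K₀ + K) (K₀ + K) s⟩ : Σ K, SiteSeqKey F (K₀ + K)) ∈ T) :
    (⟨K, twoRunKeyA F ν M (gA K) (K₀ + K) (K₀ + K) s⟩ : Σ K, SiteSeqKey F (K₀ + K)) ∉ badKeysSigma F T jcut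
      ↔ ∀ j, 1 ≤ j → j ≤ jcut K → s.Λ j = Set.univ := by
  have h1 : (⟨K, twoRunKeyA F ν M (gA K) (K₀ + K) (K₀ + K) s⟩ : Σ K, SiteSeqKey F (K₀ + K)) ∉ badKeysSigma F T jcut
      ↔ ¬ KeyOldLargeField (jcut K) (twoRunKeyA F ν M (gA K) (K₀ + K) (K₀ + K) s) := by
    rw [mem_badKeysSigma_iff]
    exact ⟨fun h hk => h ⟨hT, hk⟩, fun h hk => h hk.2⟩
  rw [h1, not_keyOldLargeField_iff]
  rfl

variable [∀ Kc, DecidableEq (SiteSeqKey F Kc)]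

open Classical in
/-- **★★ AT THE SHARED PERSISTENCE CLASS, N19's CORE EDGE IS A TERMWISE SANDWICH ON THE RUN-A SEQUENCES WITH SMALL-FIELD HISTORY UP TO THE CUT — LOSS-FREE.**
B :169's keyed data with `Bad K t := badKeysSigma F (T K) jcut` (`T K` the class set itself; policy `jcut` DISPLAYED — NE7b's is `jcut K = K₀ + K − j⋆(K)`):
`NE7.Core l₀ vol T Bad (A − shA) (B − shB) δ` IFF for every `K` ONE constant `c` such that for every `|t| ≤ l₀` and every run-A (2.18) sequence `s` at cutoff `K₀ + K`
with `s.Λ_j = T_η` for all `1 ≤ j ≤ jcut K` (NO large-field region at the OLD levels — the recent window `j > jcut K` is free):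
`e^{c − vol·δ K}·(a K t s − shA K t ⟨K, kA s⟩) ≤ (Σ_{s' : truncSeq s' = s} b K t s') − shB K t ⟨K, kA s⟩ ≤ e^{c + vol·δ K}·(a K t s − shA K t ⟨K, kA s⟩)`.
The right-hand side for Bałaban's class weights — term-wise matching of the two runs modulo one constant per `K` on the histories that are small-field at every
old level — is N19's NE7 core content jointly cut with N20's persistence class: NOT PRINTED for `d = 4`, NOT proved, NAMED OPEN.  (α) reading: dag-n20-d's, NC-NE7b-α UNRULED.
SHARPER FORM (n20-w2 `Thm/…N20TwoRunKeyedGoodFibre`, INTENT-2 l.24558, to be cited on landing): on this class `s.Λ_1 = T_η`, hence `s.Ω_1 = T_η`, and the (2.1) chain of a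
fibre point forces `Λ′_1 = Ω′_1 = T_η` — the `truncSeq`-fibre over a GOOD `s` is the SINGLETON `{liftSeq s}` (n20-d's section), so the displayed sandwich compares run A's
term `s` with run B's ONE lifted term `liftSeq s`: the same small-field history read at the two cutoffs.
[cite: King1986, (3.10) p.656; Balaban1989LargeFieldII, Thm 1 + (0.1) pp.355–356, (1.80) p.384; Balaban1989LargeFieldI, (0.2)–(0.4) p.176; Balaban1988Convergent, (2.18) p.257 (bookkeeping)] -/
theorem core_twoRunKeyed_badKeysSigma_iff_termwise (hR : ∀ K, RAgree F ν (gA K) (gB K) (K₀ + K)) (jcut : ℕ → ℕ) {l₀ vol : ℝ}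
    (a : (K : ℕ) → ℝ → SeqOfRecord F ν M (gA K) (K₀ + K) (K₀ + K) → ℝ) (b : (K : ℕ) → ℝ → SeqOfRecord F ν M (gB K) (K₀ + K + 1) (K₀ + K + 1) → ℝ)
    (shA shB : ℕ → ℝ → (Σ K, SiteSeqKey F (K₀ + K)) → ℝ) (δ : ℕ → ℝ) :
    NE7.Core l₀ vol
        (fun K => Finset.univ.image (fun s : SeqOfRecord F ν M (gA K) (K₀ + K) (K₀ + K) =>
            (⟨K, twoRunKeyA F ν M (gA K) (K₀ + K) (K₀ + K) s⟩ : Σ K, SiteSeqKey F (K₀ + K)))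
          ∪ Finset.univ.image (fun s' : SeqOfRecord F ν M (gB K) (K₀ + K + 1) (K₀ + K + 1) =>
            (⟨K, twoRunKeyB F ν hM (gB K) (K₀ + K) (K₀ + K) s'⟩ : Σ K, SiteSeqKey F (K₀ + K))))
        (fun K _ => badKeysSigma F
          (Finset.univ.image (fun s : SeqOfRecord F ν M (gA K) (K₀ + K) (K₀ + K) =>
              (⟨K, twoRunKeyA F ν M (gA K) (K₀ + K) (K₀ + K) s⟩ : Σ K, SiteSeqKey F (K₀ + K)))
            ∪ Finset.univ.image (fun s' : SeqOfRecord F ν M (gB K) (K₀ + K + 1) (K₀ + K + 1) =>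
              (⟨K, twoRunKeyB F ν hM (gB K) (K₀ + K) (K₀ + K) s'⟩ : Σ K, SiteSeqKey F (K₀ + K)))) jcut)
        (fun K t x => (∑ s ∈ Finset.univ.filter (fun s : SeqOfRecord F ν M (gA K) (K₀ + K) (K₀ + K) =>
            (⟨K, twoRunKeyA F ν M (gA K) (K₀ + K) (K₀ + K) s⟩ : Σ K, SiteSeqKey F (K₀ + K)) = x), a K t s) - shA K t x)
        (fun K t x => (∑ s' ∈ Finset.univ.filter (fun s' : SeqOfRecord F ν M (gB K) (K₀ + K + 1) (K₀ + K + 1) =>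
            (⟨K, twoRunKeyB F ν hM (gB K) (K₀ + K) (K₀ + K) s'⟩ : Σ K, SiteSeqKey F (K₀ + K)) = x), b K t s') - shB K t x) δ
      ↔ ∀ K : ℕ, ∃ c : ℝ, ∀ t : ℝ, |t| ≤ l₀ → ∀ s : SeqOfRecord F ν M (gA K) (K₀ + K) (K₀ + K),
          (∀ j, 1 ≤ j → j ≤ jcut K → s.Λ j = Set.univ) →
          Real.exp (c - vol * δ K) * (a K t s - shA K t ⟨K, twoRunKeyA F ν M (gA K) (K₀ + K) (K₀ + K) s⟩)
              ≤ (∑ s' ∈ Finset.univ.filter (fun s' : SeqOfRecord F ν M (gB K) (K₀ + K + 1) (K₀ + K + 1) => truncSeq F ν hM (hR K) s' = s), b K t s')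
                  - shB K t ⟨K, twoRunKeyA F ν M (gA K) (K₀ + K) (K₀ + K) s⟩ ∧
            (∑ s' ∈ Finset.univ.filter (fun s' : SeqOfRecord F ν M (gB K) (K₀ + K + 1) (K₀ + K + 1) => truncSeq F ν hM (hR K) s' = s), b K t s')
                  - shB K t ⟨K, twoRunKeyA F ν M (gA K) (K₀ + K) (K₀ + K) s⟩
              ≤ Real.exp (c + vol * δ K) * (a K t s - shA K t ⟨K, twoRunKeyA F ν M (gA K) (K₀ + K) (K₀ + K) s⟩) := by
  rw [core_twoRunKeyed_iff_termwise F ν K₀ hM hR a b shA shB _ δ]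
  refine forall_congr' fun K => exists_congr fun c => forall_congr' fun t => forall_congr' fun _ => forall_congr' fun s => ?_
  exact imp_congr (sigma_twoRunKeyA_not_mem_badKeysSigma_iff F ν K₀ jcut s
    (Finset.mem_union_left _ (Finset.mem_image_of_mem _ (Finset.mem_univ s)))) Iff.rfl

open Classical in
/-- **★★ B :169's `hedge` BINDER AT THE SHARED PERSISTENCE CLASS FROM THE TERMWISE SANDWICH ON SMALL-FIELD HISTORIES** (`Summable δ` added).  DISPLAYED:
`hR`, the policy `jcut`, `hδ`, the termwise sandwich on the run-A sequences with `Λ_j = T_η ∀ j ≤ jcut K` — nothing else; weights ∕ shells generic (B §2's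
`classWeightOfDatum₉ …` by instantiation, §4).  Together with n20-w1's socket and n20-w2's bad-fibre weight at the SAME `badKeysSigma F (T K) jcut` this is the complete
list of what B's four-estimate road asks of the two runs' (2.18) TERMS, split along «old large field ∕ none».
[cite: King1986, (3.10) p.656; Balaban1989LargeFieldII, Thm 1 + (0.1) pp.355–356, (1.80) p.384; Balaban1988Convergent, (2.18) p.257 (bookkeeping)] -/
theorem coreEdge_twoRunKeyed_badKeysSigma_of_termwise (hR : ∀ K, RAgree F ν (gA K) (gB K) (K₀ + K)) (jcut : ℕ → ℕ) {l₀ vol : ℝ}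
    (a : (K : ℕ) → ℝ → SeqOfRecord F ν M (gA K) (K₀ + K) (K₀ + K) → ℝ) (b : (K : ℕ) → ℝ → SeqOfRecord F ν M (gB K) (K₀ + K + 1) (K₀ + K + 1) → ℝ)
    (shA shB : ℕ → ℝ → (Σ K, SiteSeqKey F (K₀ + K)) → ℝ) {δ : ℕ → ℝ} (hδ : Summable δ)
    (hterm : ∀ K : ℕ, ∃ c : ℝ, ∀ t : ℝ, |t| ≤ l₀ → ∀ s : SeqOfRecord F ν M (gA K) (K₀ + K) (K₀ + K),
      (∀ j, 1 ≤ j → j ≤ jcut K → s.Λ j = Set.univ) →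
      Real.exp (c - vol * δ K) * (a K t s - shA K t ⟨K, twoRunKeyA F ν M (gA K) (K₀ + K) (K₀ + K) s⟩)
          ≤ (∑ s' ∈ Finset.univ.filter (fun s' : SeqOfRecord F ν M (gB K) (K₀ + K + 1) (K₀ + K + 1) => truncSeq F ν hM (hR K) s' = s), b K t s')
              - shB K t ⟨K, twoRunKeyA F ν M (gA K) (K₀ + K) (K₀ + K) s⟩ ∧
        (∑ s' ∈ Finset.univ.filter (fun s' : SeqOfRecord F ν M (gB K) (K₀ + K + 1) (K₀ + K + 1) => truncSeq F ν hM (hR K) s' = s), b K t s')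
              - shB K t ⟨K, twoRunKeyA F ν M (gA K) (K₀ + K) (K₀ + K) s⟩
          ≤ Real.exp (c + vol * δ K) * (a K t s - shA K t ⟨K, twoRunKeyA F ν M (gA K) (K₀ + K) (K₀ + K) s⟩)) :
    ∃ δ : ℕ → ℝ, NE7.Core l₀ vol
        (fun K => Finset.univ.image (fun s : SeqOfRecord F ν M (gA K) (K₀ + K) (K₀ + K) =>
            (⟨K, twoRunKeyA F ν M (gA K) (K₀ + K) (K₀ + K) s⟩ : Σ K, SiteSeqKey F (K₀ + K)))
          ∪ Finset.univ.image (fun s' : SeqOfRecord F ν M (gB K) (K₀ + K + 1) (K₀ + K + 1) =>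
            (⟨K, twoRunKeyB F ν hM (gB K) (K₀ + K) (K₀ + K) s'⟩ : Σ K, SiteSeqKey F (K₀ + K))))
        (fun K _ => badKeysSigma F
          (Finset.univ.image (fun s : SeqOfRecord F ν M (gA K) (K₀ + K) (K₀ + K) =>
              (⟨K, twoRunKeyA F ν M (gA K) (K₀ + K) (K₀ + K) s⟩ : Σ K, SiteSeqKey F (K₀ + K)))
            ∪ Finset.univ.image (fun s' : SeqOfRecord F ν M (gB K) (K₀ + K + 1) (K₀ + K + 1) =>
              (⟨K, twoRunKeyB F ν hM (gB K) (K₀ + K) (K₀ + K) s'⟩ : Σ K, SiteSeqKey F (K₀ + K)))) jcut)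
        (fun K t x => (∑ s ∈ Finset.univ.filter (fun s : SeqOfRecord F ν M (gA K) (K₀ + K) (K₀ + K) =>
            (⟨K, twoRunKeyA F ν M (gA K) (K₀ + K) (K₀ + K) s⟩ : Σ K, SiteSeqKey F (K₀ + K)) = x), a K t s) - shA K t x)
        (fun K t x => (∑ s' ∈ Finset.univ.filter (fun s' : SeqOfRecord F ν M (gB K) (K₀ + K + 1) (K₀ + K + 1) =>
            (⟨K, twoRunKeyB F ν hM (gB K) (K₀ + K) (K₀ + K) s'⟩ : Σ K, SiteSeqKey F (K₀ + K)) = x), b K t s') - shB K t x) δ ∧ Summable δ :=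
  ⟨δ, (core_twoRunKeyed_badKeysSigma_iff_termwise F ν K₀ hM hR jcut a b shA shB δ).2 hterm, hδ⟩

end Persistent

/-! ## §3b THE CUT TRADE-OFF: raising the cut policy weakens the core edge and strengthens the weight bound -/

section CutPolicy

variable (F : T4Family) {K₀ : ℕ}

/-- A later cut excuses more keys: `jcut ≤ jcut'` pointwise ⇒ `badKeysSigma F T jcut ⊆ badKeysSigma F T jcut'` (n20-d's `KeyOldLargeField.mono`).
[cite: Balaban1989LargeFieldII, (1.80) p.384 (bookkeeping)] -/
theorem badKeysSigma_mono_policy (T : Finset (Σ K, SiteSeqKey F (K₀ + K))) {jcut jcut' : ℕ → ℕ} (h : ∀ K, jcut K ≤ jcut' K) :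
    badKeysSigma F T jcut ⊆ badKeysSigma F T jcut' := by
  intro x hx
  rw [mem_badKeysSigma_iff] at hx ⊢
  exact ⟨hx.1, hx.2.mono (h x.1)⟩

/-- **RAISING THE CUT STRENGTHENS `h20`**: a `RelWeightBound` at the persistence class of policy `jcut'` implies the one at every earlier-cutting policy `jcut ≤ jcut'`
(same weights; nonnegative term weights) — a sub-class weighs less (`T4BadClassBooking.relWeightBound_mono`).  With `core_badKeysSigma_of_policy_le`: the cut policy trades
the two estimates against each other, and their JOINT content lives in the window of policies where both hold. [cite: King1986, (3.10)–(3.11) p.656; Balaban1989LargeFieldII, (1.80) p.384 (bookkeeping)] -/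
theorem relWeightBound_badKeysSigma_of_policy_le {l₀ : ℝ} (T : ℕ → Finset (Σ K, SiteSeqKey F (K₀ + K))) {jcut jcut' : ℕ → ℕ} (h : ∀ K, jcut K ≤ jcut' K)
    {A B : ℕ → ℝ → (Σ K, SiteSeqKey F (K₀ + K)) → ℝ} {W : ℕ → ℝ}
    (hA : ∀ K t, |t| ≤ l₀ → ∀ x ∈ T K, 0 ≤ A K t x) (hB : ∀ K t, |t| ≤ l₀ → ∀ x ∈ T K, 0 ≤ B K t x)
    (hW : RelWeightBound l₀ T A B (fun K _ => badKeysSigma F (T K) jcut') W) :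
    RelWeightBound l₀ T A B (fun K _ => badKeysSigma F (T K) jcut) W :=
  relWeightBound_mono hW (fun K _ _ => badKeysSigma_mono_policy F (T K) h) hA hB

variable [∀ Kc, DecidableEq (SiteSeqKey F Kc)]

/-- **RAISING THE CUT WEAKENS `hedge`**: the core edge at the persistence class of policy `jcut` implies the one at every later-cutting policy `jcut' ≥ jcut` (same
constants, same remainder) — fewer good keys to match (`…N19CoreMetric.core_of_subset`). [cite: King1986, (3.10) p.656; Balaban1989LargeFieldII, (1.80) p.384 (bookkeeping)] -/
theorem core_badKeysSigma_of_policy_le {l₀ vol : ℝ} (T : ℕ → Finset (Σ K, SiteSeqKey F (K₀ + K))) {jcut jcut' : ℕ → ℕ} (h : ∀ K, jcut K ≤ jcut' K)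
    {P Q : ℕ → ℝ → (Σ K, SiteSeqKey F (K₀ + K)) → ℝ} {δ : ℕ → ℝ}
    (hcore : NE7.Core l₀ vol T (fun K _ => badKeysSigma F (T K) jcut) P Q δ) :
    NE7.Core l₀ vol T (fun K _ => badKeysSigma F (T K) jcut') P Q δ :=
  core_of_subset le_rfl (fun K _ _ => Finset.sdiff_subset_sdiff (Finset.Subset.refl _) (badKeysSigma_mono_policy F (T K) h)) hcore

end CutPolicy

/-! ## §4 THE COMPOSITION WITH B §2's ROAD AT THE ₁₃ LIVE RE-PIN: `h20` (n20-w1's socket output shape) and `hedge` (this file) at ONE bad class -/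

section Road

variable (F : T4Family) (N : ℕ) [NeZero N] [∀ Kc, DecidableEq (SiteSeqKey F Kc)]

open Classical in
/-- **★★ N19's :183 ROAD AT NODE U5d's σ-PACKED TWO-RUN SITE KEYS WITH THE SHARED PERSISTENCE CLASS, `hedge` FED BY THE TERMWISE SANDWICH ON SMALL-FIELD
HISTORIES** — B §2 `matching_scheme_of_coreEdge_twoRunKeyed_liveRepin₁₃` BY NAME with `Bad K t := badKeysSigma F (T K) jcut` in ALL FOUR estimates and its
`hedge` binder discharged by `coreEdge_twoRunKeyed_badKeysSigma_of_termwise` at F3's class weights `classWeightOfDatum₉ … (θ.liveRepin₁₃ F N).toStage9Params …`.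
DISPLAYED: `hres hM`, bookkeeping `D hD g₀ os K₀ mA mB cA cB gA gB hgA hgB`, the flow hypothesis `hR`, the policy `jcut`, `hl₀ hvol`, N20's `h20` AT THE PERSISTENCE
CLASS (n20-w1's socket ∕ n20-w2's bad-fibre weight feed it), N21's `h21`, U4′'s `hlt`, `hδ` and THE TERMWISE SANDWICH (N19's NE7 core on small-field histories —
NOT PRINTED, NOT proved) — nothing else.  Conclusion: node U5's `∃ δ′, Summable δ′ ∧ MatchingModConstants vol l₀ δ′ (schemeZ (D.scheme g₀) os)`.
[cite: Balaban1985UV3, (6) p.257; Balaban1989LargeFieldII, Thm 1 + (0.1) pp.355–356, (1.80) p.384; Balaban1989LargeFieldI, (0.2)–(0.4) p.176; Balaban1988Convergent, (2.1) p.254, (2.18) p.257; King1986, (3.10) p.656 (bookkeeping)] -/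
theorem matching_scheme_of_termwise_relWeight_shell_twoRunKeyed_badKeysSigma_liveRepin₁₃ (θ : Stage13Params F N)
    (hres : θ.HasResidualsOfRecord F N) (hM : 0 < θ.τ9.M)
    (D : FiniteEpsData F (SU N)) (hD : D.AvgMeasurable) (g₀ : ℕ → ℝ) (os : List (ULoop F)) (K₀ : ℕ) (mA mB : ℕ → ℕ) (cA cB : ℕ → ℝ) (gA gB : ℕ → ℕ → ℝ)
    (hgA : ∀ K, gA K 0 = g₀ (K₀ + K)) (hgB : ∀ K, gB K 0 = g₀ (K₀ + K + 1))
    (hR : ∀ K, RAgree F θ.ν (gA K) (gB K) (K₀ + K)) (jcut : ℕ → ℕ)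
    {l₀ vol : ℝ} (hl₀ : 0 ≤ l₀) (hvol : 0 < vol) {shA shB : ℕ → ℝ → (Σ K, SiteSeqKey F (K₀ + K)) → ℝ} {W Wsh : ℕ → ℝ} {δ : ℕ → ℝ}
    (h20 : RelWeightBound l₀
      (fun K => Finset.univ.image (fun s : SeqOfRecord F θ.ν θ.τ9.M (gA K) (K₀ + K) (K₀ + K) =>
          (⟨K, twoRunKeyA F θ.ν θ.τ9.M (gA K) (K₀ + K) (K₀ + K) s⟩ : Σ K, SiteSeqKey F (K₀ + K)))
        ∪ Finset.univ.image (fun s' : SeqOfRecord F θ.ν θ.τ9.M (gB K) (K₀ + K + 1) (K₀ + K + 1) =>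
          (⟨K, twoRunKeyB F θ.ν hM (gB K) (K₀ + K) (K₀ + K) s'⟩ : Σ K, SiteSeqKey F (K₀ + K))))
      (fun K t x => ∑ s ∈ Finset.univ.filter (fun s : SeqOfRecord F θ.ν θ.τ9.M (gA K) (K₀ + K) (K₀ + K) =>
          (⟨K, twoRunKeyA F θ.ν θ.τ9.M (gA K) (K₀ + K) (K₀ + K) s⟩ : Σ K, SiteSeqKey F (K₀ + K)) = x),
        classWeightOfDatum₉ F N (θ.liveRepin₁₃ F N).toStage9Params D g₀ os ⟨K₀ + K, mA K, cA K⟩ (gA K) (K₀ + K) t s)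
      (fun K t x => ∑ s' ∈ Finset.univ.filter (fun s' : SeqOfRecord F θ.ν θ.τ9.M (gB K) (K₀ + K + 1) (K₀ + K + 1) =>
          (⟨K, twoRunKeyB F θ.ν hM (gB K) (K₀ + K) (K₀ + K) s'⟩ : Σ K, SiteSeqKey F (K₀ + K)) = x),
        classWeightOfDatum₉ F N (θ.liveRepin₁₃ F N).toStage9Params D g₀ os ⟨K₀ + K + 1, mB K, cB K⟩ (gB K) (K₀ + K + 1) t s')
      (fun K _ => badKeysSigma F
        (Finset.univ.image (fun s : SeqOfRecord F θ.ν θ.τ9.M (gA K) (K₀ + K) (K₀ + K) =>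
            (⟨K, twoRunKeyA F θ.ν θ.τ9.M (gA K) (K₀ + K) (K₀ + K) s⟩ : Σ K, SiteSeqKey F (K₀ + K)))
          ∪ Finset.univ.image (fun s' : SeqOfRecord F θ.ν θ.τ9.M (gB K) (K₀ + K + 1) (K₀ + K + 1) =>
            (⟨K, twoRunKeyB F θ.ν hM (gB K) (K₀ + K) (K₀ + K) s'⟩ : Σ K, SiteSeqKey F (K₀ + K)))) jcut) W)
    (h21 : ShellWeightBound l₀
      (fun K => Finset.univ.image (fun s : SeqOfRecord F θ.ν θ.τ9.M (gA K) (K₀ + K) (K₀ + K) =>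
          (⟨K, twoRunKeyA F θ.ν θ.τ9.M (gA K) (K₀ + K) (K₀ + K) s⟩ : Σ K, SiteSeqKey F (K₀ + K)))
        ∪ Finset.univ.image (fun s' : SeqOfRecord F θ.ν θ.τ9.M (gB K) (K₀ + K + 1) (K₀ + K + 1) =>
          (⟨K, twoRunKeyB F θ.ν hM (gB K) (K₀ + K) (K₀ + K) s'⟩ : Σ K, SiteSeqKey F (K₀ + K))))
      (fun K t x => ∑ s ∈ Finset.univ.filter (fun s : SeqOfRecord F θ.ν θ.τ9.M (gA K) (K₀ + K) (K₀ + K) =>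
          (⟨K, twoRunKeyA F θ.ν θ.τ9.M (gA K) (K₀ + K) (K₀ + K) s⟩ : Σ K, SiteSeqKey F (K₀ + K)) = x),
        classWeightOfDatum₉ F N (θ.liveRepin₁₃ F N).toStage9Params D g₀ os ⟨K₀ + K, mA K, cA K⟩ (gA K) (K₀ + K) t s)
      (fun K t x => ∑ s' ∈ Finset.univ.filter (fun s' : SeqOfRecord F θ.ν θ.τ9.M (gB K) (K₀ + K + 1) (K₀ + K + 1) =>
          (⟨K, twoRunKeyB F θ.ν hM (gB K) (K₀ + K) (K₀ + K) s'⟩ : Σ K, SiteSeqKey F (K₀ + K)) = x),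
        classWeightOfDatum₉ F N (θ.liveRepin₁₃ F N).toStage9Params D g₀ os ⟨K₀ + K + 1, mB K, cB K⟩ (gB K) (K₀ + K + 1) t s') shA shB Wsh)
    (hlt : ∀ K, W K + Wsh K < 1) (hδ : Summable δ)
    (hterm : ∀ K : ℕ, ∃ c : ℝ, ∀ t : ℝ, |t| ≤ l₀ → ∀ s : SeqOfRecord F θ.ν θ.τ9.M (gA K) (K₀ + K) (K₀ + K),
      (∀ j, 1 ≤ j → j ≤ jcut K → s.Λ j = Set.univ) →
      Real.exp (c - vol * δ K) *
            (classWeightOfDatum₉ F N (θ.liveRepin₁₃ F N).toStage9Params D g₀ os ⟨K₀ + K, mA K, cA K⟩ (gA K) (K₀ + K) t s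
              - shA K t ⟨K, twoRunKeyA F θ.ν θ.τ9.M (gA K) (K₀ + K) (K₀ + K) s⟩)
          ≤ (∑ s' ∈ Finset.univ.filter (fun s' : SeqOfRecord F θ.ν θ.τ9.M (gB K) (K₀ + K + 1) (K₀ + K + 1) => truncSeq F θ.ν hM (hR K) s' = s),
                classWeightOfDatum₉ F N (θ.liveRepin₁₃ F N).toStage9Params D g₀ os ⟨K₀ + K + 1, mB K, cB K⟩ (gB K) (K₀ + K + 1) t s')
              - shB K t ⟨K, twoRunKeyA F θ.ν θ.τ9.M (gA K) (K₀ + K) (K₀ + K) s⟩ ∧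
        (∑ s' ∈ Finset.univ.filter (fun s' : SeqOfRecord F θ.ν θ.τ9.M (gB K) (K₀ + K + 1) (K₀ + K + 1) => truncSeq F θ.ν hM (hR K) s' = s),
                classWeightOfDatum₉ F N (θ.liveRepin₁₃ F N).toStage9Params D g₀ os ⟨K₀ + K + 1, mB K, cB K⟩ (gB K) (K₀ + K + 1) t s')
              - shB K t ⟨K, twoRunKeyA F θ.ν θ.τ9.M (gA K) (K₀ + K) (K₀ + K) s⟩
          ≤ Real.exp (c + vol * δ K) *
            (classWeightOfDatum₉ F N (θ.liveRepin₁₃ F N).toStage9Params D g₀ os ⟨K₀ + K, mA K, cA K⟩ (gA K) (K₀ + K) t s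
              - shA K t ⟨K, twoRunKeyA F θ.ν θ.τ9.M (gA K) (K₀ + K) (K₀ + K) s⟩)) :
    ∃ δ' : ℕ → ℝ, Summable δ' ∧ MatchingModConstants vol l₀ δ' (T4GenFunBounds.schemeZ (D.scheme g₀) os) :=
  matching_scheme_of_coreEdge_twoRunKeyed_liveRepin₁₃ F N θ hres hM D hD g₀ os K₀ mA mB cA cB gA gB hgA hgB hl₀ hvol h20 h21 hlt
    (coreEdge_twoRunKeyed_badKeysSigma_of_termwise F θ.ν K₀ hM hR jcut
      (fun K t s => classWeightOfDatum₉ F N (θ.liveRepin₁₃ F N).toStage9Params D g₀ os ⟨K₀ + K, mA K, cA K⟩ (gA K) (K₀ + K) t s)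
      (fun K t s' => classWeightOfDatum₉ F N (θ.liveRepin₁₃ F N).toStage9Params D g₀ os ⟨K₀ + K + 1, mB K, cB K⟩ (gB K) (K₀ + K + 1) t s')
      shA shB hδ hterm)

end Road

end Summit.QuantumFields.YangMills.BalabanUVNodes.N20CoreEdgeAtPersistentKeys

end
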